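import Literature.NumberTheory.EllipticCurves.GeomPointReduction
import Literature.NumberTheory.EllipticCurves.HeegnerPointsKolyvaginConjugation
import HarnessLib

/-!
# The CM automorphisms `[ζ] : (x, y) ↦ (ζ x, y)` of a `j = 0` curve under reduction at a good
# place, and the Frobenius FLIP `[ζ]~ ∘ Frob_ℓ = Frob_ℓ ∘ [ζ]~²` at a prime `ℓ ≡ 2 (mod 3)`

Topic `NumberTheory/EllipticCurves`; namespace `Literature.NumberTheory.EllipticCurves.JZero`.
THEOREMS ONLY (D-0026: no definition, no named fact, no `sorry`).  Companion of
`CubicTwistTransportJZero` (the CM automorphisms `ρ_g = [ζ_g]`, `[ζ](x, y) = (ζ x, y)`, of a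
`j = 0` model over `K̄` and the cubic-twist transport) and of `KolyvaginClassFlipSupersingular` §4
(`JZero.zsmul_kolyvaginClass_cubicTwist_mem_selmerLocalKer_iff_mem_torsionLocalKer`), whose two
displayed hypotheses on the reduction datum at a Kolyvagin prime `λ ∣ ℓ`,

* `hredρ : red (ρ_g x) = ρ̃_g (red x)` — *the CM automorphisms reduce*: along a place `𝔓 ∣ ℓ` of
  good reduction the automorphism `[ζ]` of `E(K̄)` is carried by the reduction map
  `red : E(K̄) → Ẽ(𝔽̄_ℓ)` to the automorphism `[ζ̄]` of `Ẽ(𝔽̄_ℓ)`, `ζ̄` the residue of `ζ`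
  (Lang, *Elliptic Functions*, Ch. 9 §1: the place acts on the coordinates of points; Silverman,
  *AEC*, VII.2.1; Silverman, *Advanced Topics*, II.§4: reduction of endomorphisms), and
* `hφρ : ρ̃_g ∘ φ = φ ∘ ρ̃_g²` — *Frobenius FLIPS the CM action at an inert prime*: for the
  `ℓ`-power Frobenius `φ` of `𝔽̄_ℓ` and `ℓ ≡ 2 (mod 3)` one has `φ(ζ̄ X) = ζ̄^ℓ X^ℓ = ζ̄² φ(X)`,
  i.e. `[ζ̄] ∘ φ = φ ∘ [ζ̄²] = φ ∘ [ζ̄]²` on `Ẽ(𝔽̄_ℓ)` (the coordinate form of Silverman, *Advanced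
  Topics*, Thm. II.2.2 (a): *"`[α]_E^σ = [α^σ]_{E^σ}` for all `α ∈ R` and all `σ ∈ Aut(ℂ)`"*, here
  for the Frobenius of the residue field, which acts on `μ₃` by `ζ ↦ ζ^ℓ = ζ̄ = ζ²` when
  `ℓ ≡ 2 (mod 3)`; cell memo "two" §57.3 (iii): *"Frob(λ′) conjugates the CM action —
  `Frob(λ′) ∘ [α] = [ᾱ] ∘ Frob(λ′)`"*),

are discharged here for the concrete datum of the tree: `red x = geomReduction hΔ (θ⁻¹ (g₀⁻¹ x))`
(`GeomPointReduction`, `θ = RatClosure.pointsEquiv`: the shape of the first conjunct of the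
reduction data built under `Summits/`), for a globally minimal model `W₀/ℚ` with
`a₁ = a₂ = a₄ = 0` (`a₃` arbitrary: the minimal models of the `j = 0` curves with good reduction at
`2`, e.g. `y² + y = x³ - 1`, are not short), composed with a frame transport
`κ : E(K̄) ≃ W₀(K̄)` which is diagonal on `x` (`κ(x, y) = (a x, b y + d)`: any change of variables
with `r = s = 0`, e.g. from the short model `y² = x³ - 432·9²` of `E_9 : x³ + y³ = 9` to the minimal
model `y² + y = x³ - 1` (`Δ = -3⁵`), `(u, r, s, t) = (6, 0, 0, 108)`).

## Contents

* §1 `JZero.exists_mulX_pointEquiv`, `JZero.exists_mulX_geomPoints` — the automorphism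
  `[ζ] : (x, y) ↦ (ζ x, y)`, `ζ³ = 1`, of the points of ANY model with `a₁ = a₂ = a₄ = 0` (no
  condition on `a₃`, `a₆`: the minimal models of the `j = 0` curves with good reduction at `2` are
  `y² + y = x³ + A`, not short; the tree's `JZero.exists_mulX_addEquiv` wants `a₃ = 0`), as the
  change of variables `(u, r, s, t) = (ζ⁻², 0, 0, 0)` (Silverman, *AEC*, III.10.1: for `j = 0`
  the automorphisms are `(x, y) ↦ (u²x, u³y)`, `u ∈ μ₆`).
* §2 `JZero.frame_mulX_comm` — `[ζ]` commutes with every transport diagonal on `x`;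
  `JZero.exists_frameTransport` — the transport `E(K̄) ≃+ X(K̄)` of a change of variables over `K`
  with `r = s = 0` onto `C • E = X`, `Γ_K`-equivariant and diagonal on `x`.
* §3 `JZero.mulX_frobenius_flip` — `[ζ] (φ b) = φ ([ζ]([ζ] b))` on `V(k̄)` for the `q`-power
  Frobenius `φ`, `q ≡ 2 (mod 3)`.
* §4 `JZero.geomReduction_mulX_of_eq_some` — over `ℚ̄`: `red([ζ](x, y)) = [ζ̄](red(x, y))` along the
  place `𝔓 = placeOver ℓ` (`v_𝔓(ζ) = 1`; non-integral `x` ↦ `Õ` on both sides; integral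
  `(x, y) ↦ (x̄, ȳ)`).
* §5 `JZero.exists_reduced_mulX` — over `K`: for `red x = geomReduction hΔ (θ⁻¹ (g₀⁻¹ x))` and a
  family `ρ_i(x, y) = (c_i x, y)`, `c_i³ = 1`, the reduced family `ρ̃_i = [z_i]`, `z_i³ = 1`, with
  `red ∘ ρ_i = ρ̃_i ∘ red` and, for `ℓ ≡ 2 (mod 3)`, the FLIP `ρ̃_i ∘ φ = φ ∘ ρ̃_i²`.
* §6 `JZero.exists_reduced_mulX_frame` — the one-call dictionary for §4 of
  `KolyvaginClassFlipSupersingular`: from the reduction datum of `W₀` (`red₀` `I`-invariant,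
  `red₀ ∘ F = φ² ∘ red₀`, `red₀` injective on `E[n]`) and a frame transport `κ`, the datum for
  `red = red₀ ∘ κ` on the frame curve together with `ρ̃`, `hredρ` and `hφρ`.

Everything is proved; nothing here is specific to a prime `p`, asserts anything about a Selmer
group, or about BSD.

## References

* [SilvermanAEC2009] J. H. Silverman, *The Arithmetic of Elliptic Curves*, 2nd ed., GTM 106:
  III.1 Table 3.1, III.10.1 (`Aut E ≅ μ₆` for `j = 0`), VII.2.1 (reduction on coordinates).
* [Silverman1994] J. H. Silverman, *Advanced Topics in the Arithmetic of Elliptic Curves*, GTM 151: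
  Thm. II.2.2 (a) (`[α]_E^σ = [α^σ]_{E^σ}`), II.§4 (reduction of endomorphisms).
* [Lang1987] S. Lang, *Elliptic Functions*, 2nd ed., GTM 112: Ch. 9 §1 (reduction of points along a
  place, PDF pp. 82–83), Ch. 13 §4 (PDF p. 139).
* [HuShuYin2019] Y. Hu, J. Shu, H. Yin, Trans. AMS 372 (2019), §1 p. 4 (`[ω](x, y) = (ω x, y)`).
* [GrossLMS1991] B. H. Gross, LMS LN 153 (1991), Prop. 6.2 (2); [McCallumLMS1991] W. G. McCallum,
  ibid., Prop. 4.4 — the local argument into which the FLIP enters (cell memo "two" §57.3 (iii)).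
-/

noncomputable section

open scoped Classical
open WeierstrassCurve Field
open Literature.NumberTheory.GaloisRepresentations

universe u v

namespace Literature.NumberTheory.EllipticCurves

namespace JZero

/-! ## §1. The automorphism `[ζ] : (x, y) ↦ (ζ x, y)` of a model with `a₁ = a₂ = a₄ = 0` -/

section MulX

variable {F : Type u} [Field F] (V : WeierstrassCurve F)

/-- **The CM automorphism `[ζ]` on points.**  For a Weierstrass model `V` over a field `F` with
`a₁ = a₂ = a₄ = 0` (`y² + a₃ y = x³ + a₆`; no condition on `a₃`, `a₆`) and `ζ ∈ F` with `ζ³ = 1`,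
the substitution `(x, y) ↦ (ζ x, y)` is an automorphism of the group `V(F)`: it is the change of
variables `(u, r, s, t) = (ζ⁻², 0, 0, 0)` (`u⁻² = ζ⁴ = ζ`, `u⁻³ = ζ⁶ = 1`), which fixes the
equation (`a₃ ↦ u⁻³ a₃`, `a₆ ↦ u⁻⁶ a₆`), followed by the transport along `C • V = V`
(Silverman, *AEC*, III.1 Table 3.1, III.10.1; Hu–Shu–Yin's `[ω](x, y) = (ω x, y)`).
[cite: SilvermanAEC2009, Thm. III.10.1] [cite: HuShuYin2019, §1 p. 4] -/
theorem exists_mulX_pointEquiv (h₁ : V.a₁ = 0) (h₂ : V.a₂ = 0) (h₄ : V.a₄ = 0) {ζ : F}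
    (hζ : ζ ^ 3 = 1) :
    ∃ ρ : V.toAffine.Point ≃+ V.toAffine.Point,
      ∀ {x y : F} (h : V.toAffine.Nonsingular x y), ∃ h', ρ (.some x y h) = .some (ζ * x) y h' := by
  have hζ0 : ζ ≠ 0 := by
    rintro rfl
    norm_num at hζ
  have hw : ζ ^ 2 ≠ 0 := pow_ne_zero 2 hζ0
  have hw3 : (ζ ^ 2) ^ 3 = 1 := by
    calc (ζ ^ 2) ^ 3 = (ζ ^ 3) ^ 2 := by ring
      _ = 1 := by rw [hζ, one_pow]
  let C : VariableChange F := ⟨(Units.mk0 (ζ ^ 2) hw)⁻¹, 0, 0, 0⟩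
  have hCu : ((C.u⁻¹ : Fˣ) : F) = ζ ^ 2 := by
    change (((Units.mk0 (ζ ^ 2) hw)⁻¹)⁻¹ : Fˣ) = (ζ ^ 2 : F)
    rw [inv_inv, Units.val_mk0]
  have hC : C • V = V := by
    ext
    · rw [variableChange_a₁, h₁]; simp [C]
    · rw [variableChange_a₂, h₁, h₂]; simp [C]
    · rw [variableChange_a₃, hCu, h₁]; simp [C, hw3]
    · rw [variableChange_a₄, h₁, h₂, h₄]; simp [C]
    · rw [variableChange_a₆, hCu, h₁, h₂, h₄]
      simp only [C, zero_mul, mul_zero, add_zero, sub_zero, zero_pow three_ne_zero,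
        zero_pow two_ne_zero]
      calc (ζ ^ 2) ^ 6 * V.a₆ = ((ζ ^ 2) ^ 3) ^ 2 * V.a₆ := by ring
        _ = V.a₆ := by rw [hw3, one_pow, one_mul]
  refine ⟨(VariableChange.pointEquiv V C).trans (Affine.Point.congrEquiv hC), fun {x y} h ↦ ?_⟩
  have hx : C.toX x = ζ * x := by
    rw [VariableChange.toX_def, hCu]
    simp only [C, sub_zero]
    calc (ζ ^ 2) ^ 2 * x = ζ ^ 3 * ζ * x := by ring
      _ = ζ * x := by rw [hζ, one_mul]
  have hy : C.toY x y = y := by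
    rw [VariableChange.toY_def, hCu]
    simp only [C, sub_zero, zero_mul]
    rw [hw3, one_mul]
  have h' : V.toAffine.Nonsingular (ζ * x) y := by
    have := (VariableChange.nonsingular_iff V C x y).mpr h
    rw [hx, hy, hC] at this
    exact this
  refine ⟨h', ?_⟩
  rw [AddEquiv.trans_apply, VariableChange.pointEquiv_some, Affine.Point.congrEquiv_some]
  exact Affine.Point.some_eq_some_of_eq hx hy

end MulX

section Geom

variable {k : Type u} [Field k]

/-- The `Γ_k`-action on an affine geometric point is coordinatewise (definitionally).
Silverman, *AEC*, VIII.§1. [folklore] -/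
private theorem smul_some_eq (V : WeierstrassCurve k) (g : absoluteGaloisGroup k)
    {x y : AlgebraicClosure k} (h : (V.baseChange (AlgebraicClosure k)).toAffine.Nonsingular x y) :
    ∃ h', @HSMul.hSMul (absoluteGaloisGroup k) (geomPoints V) (geomPoints V) instHSMul g
        (Affine.Point.some x y h) = Affine.Point.some (g • x) (g • y) h' :=
  ⟨_, rfl⟩

/-- **`[ζ]` on geometric points**: for a model `V/k` with `a₁ = a₂ = a₄ = 0` and `ζ ∈ k̄` with
`ζ³ = 1`, an automorphism of `V(k̄)` acting by `(x, y) ↦ (ζ x, y)` (§1 over `k̄`; cf. the tree's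
`JZero.exists_mulX_addEquiv`, which assumes moreover `a₃ = 0`).
[cite: SilvermanAEC2009, Thm. III.10.1] [cite: HuShuYin2019, §1 p. 4] -/
theorem exists_mulX_geomPoints (V : WeierstrassCurve k) (h₁ : V.a₁ = 0) (h₂ : V.a₂ = 0)
    (h₄ : V.a₄ = 0) {ζ : AlgebraicClosure k} (hζ : ζ ^ 3 = 1) :
    ∃ ρ : geomPoints V ≃+ geomPoints V,
      ∀ {x y : AlgebraicClosure k} (h : (V.baseChange (AlgebraicClosure k)).toAffine.Nonsingular x y),
        ∃ h', ρ (.some x y h) = .some (ζ * x) y h' :=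
  exists_mulX_pointEquiv (V.baseChange (AlgebraicClosure k))
    (show algebraMap k _ V.a₁ = 0 by rw [h₁, map_zero]) (show algebraMap k _ V.a₂ = 0 by rw [h₂, map_zero])
    (show algebraMap k _ V.a₄ = 0 by rw [h₄, map_zero]) hζ

/-! ## §2. Frame transports diagonal on `x` -/

/-- **`[ζ]` commutes with every transport diagonal on `x`.**  If `κ : W(k̄) → X(k̄)` maps `O ↦ O`
and `(x, y) ↦ (a x, b y + d)`, and `ρ`, `ρ₀` act on `W(k̄)`, `X(k̄)` by `(x, y) ↦ (ζ x, y)`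
(and fix `O`), then `κ ∘ ρ = ρ₀ ∘ κ` (both send `(x, y)` to `(ζ a x, b y + d)`).  Used with `κ` the
transport of a change of variables with `r = s = 0` (`exists_frameTransport`).
[cite: SilvermanAEC2009, III.1 Table 3.1, Thm. III.10.1] -/
theorem frame_mulX_comm {W X : WeierstrassCurve k} {κ : geomPoints W → geomPoints X}
    {a b d : AlgebraicClosure k} (hκ0 : κ 0 = 0)
    (hκ : ∀ {x y : AlgebraicClosure k} (h : (W.baseChange (AlgebraicClosure k)).toAffine.Nonsingular x y),
      ∃ h', κ (.some x y h) = .some (a * x) (b * y + d) h')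
    {ζ : AlgebraicClosure k} {ρ : geomPoints W → geomPoints W} (hρ0 : ρ 0 = 0)
    (hρ : ∀ {x y : AlgebraicClosure k} (h : (W.baseChange (AlgebraicClosure k)).toAffine.Nonsingular x y),
      ∃ h', ρ (.some x y h) = .some (ζ * x) y h')
    {ρ₀ : geomPoints X → geomPoints X} (hρ₀0 : ρ₀ 0 = 0)
    (hρ₀ : ∀ {x y : AlgebraicClosure k} (h : (X.baseChange (AlgebraicClosure k)).toAffine.Nonsingular x y),
      ∃ h', ρ₀ (.some x y h) = .some (ζ * x) y h')
    (P : geomPoints W) : κ (ρ P) = ρ₀ (κ P) := by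
  rcases P with _ | ⟨x, y, h⟩
  · change κ (ρ 0) = ρ₀ (κ 0)
    rw [hρ0, hκ0, hρ₀0]
  · obtain ⟨h₁, e₁⟩ := hρ h
    obtain ⟨h₂, e₂⟩ := hκ h₁
    obtain ⟨h₃, e₃⟩ := hκ h
    obtain ⟨h₄, e₄⟩ := hρ₀ h₃
    refine ((congrArg κ e₁).trans e₂).trans (((congrArg ρ₀ e₃).trans e₄).trans ?_).symm
    exact Affine.Point.some_eq_some_of_eq (by ring) rfl

/-- Transport along an equality of Weierstrass equations over `k̄` is `Γ_k`-equivariant on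
geometric points (it is the identity on coordinates). [folklore] -/
private theorem congrEquiv_smul {V₁ V₂ : WeierstrassCurve k}
    (e : V₁.baseChange (AlgebraicClosure k) = V₂.baseChange (AlgebraicClosure k))
    (g : absoluteGaloisGroup k) (P : geomPoints V₁) :
    Affine.Point.congrEquiv e (g • P) =
      @HSMul.hSMul (absoluteGaloisGroup k) (geomPoints V₂) (geomPoints V₂) instHSMul g
        (Affine.Point.congrEquiv e P) := by
  rcases P with _ | ⟨x, y, h⟩
  · change Affine.Point.congrEquiv e (g • (0 : geomPoints V₁)) =
      @HSMul.hSMul (absoluteGaloisGroup k) (geomPoints V₂) (geomPoints V₂) instHSMul g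
        (Affine.Point.congrEquiv e (0 : geomPoints V₁))
    have h0 : Affine.Point.congrEquiv e (0 : geomPoints V₁) = (0 : geomPoints V₂) :=
      Affine.Point.congrEquiv_zero e
    rw [(smul_zero g : g • (0 : geomPoints V₁) = 0), h0]
    exact (smul_zero g : @HSMul.hSMul (absoluteGaloisGroup k) (geomPoints V₂) (geomPoints V₂)
      instHSMul g 0 = 0).symm
  · obtain ⟨h₁, e₁⟩ := smul_some_eq V₁ g h
    obtain ⟨h₂, e₂⟩ := smul_some_eq V₂ g (e ▸ h)
    refine ((congrArg (Affine.Point.congrEquiv e) e₁).trans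
      (Affine.Point.congrEquiv_some e h₁)).trans ?_
    refine (((congrArg (fun Q ↦ @HSMul.hSMul (absoluteGaloisGroup k) (geomPoints V₂) (geomPoints V₂)
      instHSMul g Q) (Affine.Point.congrEquiv_some e h)).trans e₂).trans ?_).symm
    exact Affine.Point.some_eq_some_of_eq rfl rfl

/-- **The frame transport of a change of variables with `r = s = 0`.**  For Weierstrass models
`W`, `X` over `k` and a change of variables `C = (u, 0, 0, t)` over `k` with `C • W = X`, the
induced isomorphism `κ : W(k̄) ≃+ X(k̄)` (the tree's `VariableChange.pointEquivBaseChange` over `k̄`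
followed by the transport along `(C • W)_{k̄} = X_{k̄}`) is `Γ_k`-equivariant
(`pointEquivBaseChange_map_algEquiv`: the substitution has coefficients in `k`) and diagonal on
`x`: `κ(x, y) = (u⁻² x, u⁻³ y - u⁻³ t)` (Silverman, *AEC*, III.1 Table 3.1; e.g. the short model
`y² = x³ - 432·81` of `E_9 : x³ + y³ = 9` onto the minimal model `y² + y = x³ - 1` (`Δ = -3⁵`),
`(u, t) = (6, 108)`: `a₃' = 2t/u³ = 1`, `a₆' = (a₆ - t²)/u⁶ = -1`).
[cite: SilvermanAEC2009, III.1 Table 3.1, III.3.1(b)] -/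
theorem exists_frameTransport {W X : WeierstrassCurve k} {C : VariableChange k} (hr : C.r = 0)
    (hs : C.s = 0) (hC : C • W = X) :
    ∃ κ : geomPoints W ≃+ geomPoints X,
      (∀ (g : absoluteGaloisGroup k) (P : geomPoints W), κ (g • P) = g • κ P) ∧
      ∃ a b d : AlgebraicClosure k, a ≠ 0 ∧
        ∀ {x y : AlgebraicClosure k} (h : (W.baseChange (AlgebraicClosure k)).toAffine.Nonsingular x y),
          ∃ h', κ (.some x y h) = .some (a * x) (b * y + d) h' := by
  have e : (C • W).baseChange (AlgebraicClosure k) = X.baseChange (AlgebraicClosure k) := by rw [hC]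
  let κ₁ := VariableChange.pointEquivBaseChange W C (AlgebraicClosure k)
  let κ₂ : ((C • W).baseChange (AlgebraicClosure k)).toAffine.Point ≃+
      (X.baseChange (AlgebraicClosure k)).toAffine.Point := Affine.Point.congrEquiv e
  let κ : geomPoints W ≃+ geomPoints X := κ₁.trans κ₂
  have hκ : ∀ P, κ P = κ₂ (κ₁ P) := fun P ↦ rfl
  have hX : ∀ x : AlgebraicClosure k, (C.map (algebraMap k (AlgebraicClosure k))).toX x =
      algebraMap k (AlgebraicClosure k) ((C.u⁻¹ : kˣ) : k) ^ 2 * x := fun x ↦ by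
    rw [VariableChange.toX_def]
    simp [VariableChange.map, hr]
  have hY : ∀ x y : AlgebraicClosure k, (C.map (algebraMap k (AlgebraicClosure k))).toY x y =
      algebraMap k (AlgebraicClosure k) ((C.u⁻¹ : kˣ) : k) ^ 3 * y +
        -(algebraMap k (AlgebraicClosure k) ((C.u⁻¹ : kˣ) : k) ^ 3 *
          algebraMap k (AlgebraicClosure k) C.t) := fun x y ↦ by
    rw [VariableChange.toY_def]
    simp [VariableChange.map, hr, hs]
    ring
  refine ⟨κ, fun g P ↦ ?_, algebraMap k (AlgebraicClosure k) ((C.u⁻¹ : kˣ) : k) ^ 2,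
    algebraMap k (AlgebraicClosure k) ((C.u⁻¹ : kˣ) : k) ^ 3,
    -(algebraMap k (AlgebraicClosure k) ((C.u⁻¹ : kˣ) : k) ^ 3 * algebraMap k (AlgebraicClosure k) C.t),
    pow_ne_zero 2 (by rw [map_ne_zero]; exact (C.u⁻¹).ne_zero), fun {x y} h ↦ ?_⟩
  · rw [hκ, hκ]
    have h1 : κ₁ (g • P) = @HSMul.hSMul (absoluteGaloisGroup k) (geomPoints (C • W))
        (geomPoints (C • W)) instHSMul g (κ₁ P) :=
      VariableChange.pointEquivBaseChange_map_algEquiv W C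
        (show AlgebraicClosure k ≃ₐ[k] AlgebraicClosure k from g) P
    rw [h1]
    exact congrEquiv_smul e g _
  · have hns : (X.baseChange (AlgebraicClosure k)).toAffine.Nonsingular
        (algebraMap k (AlgebraicClosure k) ((C.u⁻¹ : kˣ) : k) ^ 2 * x)
        (algebraMap k (AlgebraicClosure k) ((C.u⁻¹ : kˣ) : k) ^ 3 * y +
          -(algebraMap k (AlgebraicClosure k) ((C.u⁻¹ : kˣ) : k) ^ 3 *
            algebraMap k (AlgebraicClosure k) C.t)) := by
      have := (VariableChange.nonsingular_iff (W.baseChange (AlgebraicClosure k))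
        (C.map (algebraMap k (AlgebraicClosure k))) x y).mpr h
      rw [← VariableChange.baseChange_smul_eq, e, hX, hY] at this
      exact this
    refine ⟨hns, ?_⟩
    rw [hκ]
    refine (congrArg κ₂ (VariableChange.pointEquivBaseChange_some W C (AlgebraicClosure k) h)).trans ?_
    refine (Affine.Point.congrEquiv_some e _).trans ?_
    exact Affine.Point.some_eq_some_of_eq (hX x) (hY x y)

/-! ## §3. The Frobenius FLIP `[ζ] ∘ φ = φ ∘ [ζ]²` for `q ≡ 2 (mod 3)` -/

/-- **Frobenius flips the CM action.**  On `V(k̄)` let `ρ = [ζ]` act by `(x, y) ↦ (ζ x, y)` with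
`ζ³ = 1`, and let `φ ∈ Γ_k` act on `k̄` as the `q`-power map (`k = 𝔽_q`-Frobenius) with
`q ≡ 2 (mod 3)`.  Then `ρ (φ b) = φ (ρ (ρ b))` for every `b ∈ V(k̄)`: on coordinates
`ζ X^q = (ζ² X)^q` because `ζ^{2q} = ζ` (`2q ≡ 1 (mod 3)`).  This is `[ζ̄]^φ = [φ(ζ̄)] = [ζ̄²]`,
the residue-field case of Silverman, *Advanced Topics*, Thm. II.2.2 (a) (`[α]_E^σ = [α^σ]_{E^σ}`):
at a prime `ℓ ≡ 2 (mod 3)` (inert in `ℚ(ω)`) Frobenius conjugates the CM by `ℤ[ω]`.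
[cite: Silverman1994, Thm. II.2.2 (a)] [cite: SilvermanAEC2009, Thm. III.10.1] -/
theorem mulX_frobenius_flip {V : WeierstrassCurve k} {ζ : AlgebraicClosure k} (hζ : ζ ^ 3 = 1)
    {ρ : geomPoints V → geomPoints V} (hρ0 : ρ 0 = 0)
    (hρ : ∀ {x y : AlgebraicClosure k} (h : (V.baseChange (AlgebraicClosure k)).toAffine.Nonsingular x y),
      ∃ h', ρ (.some x y h) = .some (ζ * x) y h')
    {φ₀ : absoluteGaloisGroup k} {q : ℕ} (hφ : ∀ x : AlgebraicClosure k, φ₀ • x = x ^ q)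
    (hq : q % 3 = 2) (b : geomPoints V) : ρ (φ₀ • b) = φ₀ • ρ (ρ b) := by
  obtain ⟨m, rfl⟩ : ∃ m, q = 3 * m + 2 := ⟨q / 3, by omega⟩
  rcases b with _ | ⟨X, Y, h⟩
  · change ρ (φ₀ • (0 : geomPoints V)) = φ₀ • ρ (ρ 0)
    rw [smul_zero, hρ0, hρ0, smul_zero]
  · obtain ⟨h₁, e₁⟩ := smul_some_eq V φ₀ h
    obtain ⟨h₂, e₂⟩ := hρ h₁
    obtain ⟨h₃, e₃⟩ := hρ h
    obtain ⟨h₄, e₄⟩ := hρ h₃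
    obtain ⟨h₅, e₅⟩ := smul_some_eq V φ₀ h₄
    refine ((congrArg ρ e₁).trans e₂).trans
      ((((congrArg (fun P ↦ φ₀ • ρ P) e₃).trans ((congrArg (φ₀ • ·) e₄).trans e₅)).trans ?_).symm)
    refine Affine.Point.some_eq_some_of_eq ?_ rfl
    rw [hφ, hφ]
    calc (ζ * (ζ * X)) ^ (3 * m + 2) = (ζ ^ 3) ^ (2 * m + 1) * ζ * X ^ (3 * m + 2) := by ring
      _ = ζ * X ^ (3 * m + 2) := by rw [hζ, one_pow, one_mul]

end Geom

/-! ## §4. Over `ℚ̄`: `red ∘ [ζ] = [ζ̄] ∘ red` along the place `𝔓 ∣ ℓ` -/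

section RatSide

variable {ℓ : ℕ} [Fact ℓ.Prime] {W₀ : WeierstrassCurve ℚ} [W₀.IsGloballyMinimal]
  (hΔ : ¬ (ℓ : ℤ) ∣ minimalDiscriminantInt W₀)

/-- A root of unity of `ℚ̄` has valuation `1` at the place `𝔓` (`v(ζ)^n = v(1) = 1` in the
linearly ordered value group). [folklore] -/
private theorem valuation_placeOver_eq_one_of_pow_eq_one {ζ : AlgebraicClosure ℚ} {n : ℕ}
    (hn : n ≠ 0) (hζ : ζ ^ n = 1) : (placeOver ℓ).valuation ζ = 1 := by
  have h3 : (placeOver ℓ).valuation ζ ^ n = 1 := by rw [← map_pow, hζ, map_one]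
  rcases lt_trichotomy ((placeOver ℓ).valuation ζ) 1 with h | h | h
  · exact absurd h3 (pow_lt_one₀ zero_le h hn).ne
  · exact h
  · exact absurd h3 (one_lt_pow₀ h hn).ne'

/-- A root of unity of `ℚ̄` is `𝔓`-integral. [folklore] -/
private theorem mem_placeOver_of_pow_eq_one {ζ : AlgebraicClosure ℚ} {n : ℕ} (hn : n ≠ 0)
    (hζ : ζ ^ n = 1) : ζ ∈ placeOver ℓ :=
  ((placeOver ℓ).valuation_le_one_iff ζ).mp (valuation_placeOver_eq_one_of_pow_eq_one hn hζ).le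

/-- The residue `ζ̄ ∈ 𝔽̄_ℓ` of a root of unity `ζ` (`ζ^n = 1`) satisfies `ζ̄^n = 1`. [folklore] -/
private theorem placeResidueMap_pow_eq_one {ζ : AlgebraicClosure ℚ} {n : ℕ} (hn : n ≠ 0)
    (hζ : ζ ^ n = 1) :
    placeResidueMap ℓ ⟨ζ, mem_placeOver_of_pow_eq_one hn hζ⟩ ^ n = 1 := by
  rw [← map_pow]
  have : (⟨ζ, mem_placeOver_of_pow_eq_one hn hζ⟩ : placeOver ℓ) ^ n = 1 :=
    Subtype.ext (by simpa using hζ)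
  rw [this, map_one]

/-- **The CM automorphisms reduce** (`red ∘ [ζ] = [ζ̄] ∘ red` on affine points).  Let `E = W₀/ℚ`
be globally minimal, `ℓ ∤ Δ_{W₀}`, `red = geomReduction hΔ : E(ℚ̄) → Ẽ(𝔽̄_ℓ)` the reduction along
the place `𝔓 = placeOver ℓ`, `ζ ∈ ℚ̄` a root of unity with residue `z = ζ̄ = placeResidueMap ℓ ζ`,
and `ρ̃` a map on `Ẽ(𝔽̄_ℓ)` fixing `Õ` and acting on affine points by `(X, Y) ↦ (z X, Y)`.  Then
`red(P₁) = ρ̃ (red(P))` for all points `P = (x, y)`, `P₁ = (ζ x, y)` of `E(ℚ̄)`: if `x` is not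
`𝔓`-integral neither is `ζ x` (`v_𝔓(ζ) = 1`) and both sides are `Õ`
(`geomReduction_some_of_one_lt`); if `x` is integral so is `y`, and both sides are `(ζ̄ x̄, ȳ)`
(`geomReduction_some_coe`; the residue map is multiplicative) — Lang: *"this place induces a
homomorphism … by applying the bar to the coordinates of points"*.  (The points are bound as
elements of `W₀.geomPoints`, which fixes the `ℚ`-algebra structure of `ℚ̄` used by
`GeomPointReduction`.)
[cite: Lang1987, Ch. 9 §1 (PDF pp. 82–83)] [cite: SilvermanAEC2009, Prop. VII.2.1]
[cite: Silverman1994, II.§4 (reduction of endomorphisms)] -/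
theorem geomReduction_mulX_of_eq_some {ζ : AlgebraicClosure ℚ} {n : ℕ} (hn : n ≠ 0)
    (hζ : ζ ^ n = 1) {z : AlgebraicClosure (ZMod ℓ)}
    (hz : placeResidueMap ℓ ⟨ζ, mem_placeOver_of_pow_eq_one hn hζ⟩ = z)
    {ρt : (reductionModPrime W₀ ℓ).geomPoints → (reductionModPrime W₀ ℓ).geomPoints}
    (hρt0 : ρt 0 = 0)
    (hρt : ∀ {X Y : AlgebraicClosure (ZMod ℓ)}
      (h : ((reductionModPrime W₀ ℓ).baseChange (AlgebraicClosure (ZMod ℓ))).toAffine.Nonsingular X Y),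
      ∃ h', ρt (.some X Y h) = .some (z * X) Y h')
    {x y : AlgebraicClosure ℚ} {P P₁ : W₀.geomPoints} {h h₁} (hP : P = .some x y h)
    (hP₁ : P₁ = .some (ζ * x) y h₁) :
    geomReduction hΔ P₁ = ρt (geomReduction hΔ P) := by
  subst hP hP₁
  have hv := integers_placeOver ℓ
  have hvζ := valuation_placeOver_eq_one_of_pow_eq_one (ℓ := ℓ) hn hζ
  by_cases hx : (placeOver ℓ).valuation x ≤ 1
  · -- integral `x`: `y` is integral too, and both sides are `(ζ̄ x̄, ȳ)`
    have hE : ((placeModel ℓ W₀).baseChange (AlgebraicClosure ℚ)).toAffine.Equation x y := by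
      rw [placeModel_baseChange]; exact h.1
    have hy := v_Y_le_one_of_v_X_le_one hv hE hx
    obtain ⟨a, ha⟩ := hv.exists_of_le_one hx
    obtain ⟨b, hb⟩ := hv.exists_of_le_one hy
    change (a : AlgebraicClosure ℚ) = x at ha
    change (b : AlgebraicClosure ℚ) = y at hb
    subst ha hb
    set ζ₀ : placeOver ℓ := ⟨ζ, mem_placeOver_of_pow_eq_one hn hζ⟩ with hζ₀
    obtain ⟨h₂, e₂⟩ := geomReduction_some_coe hΔ a b h
    obtain ⟨h₃, e₃⟩ := geomReduction_some_coe hΔ (ζ₀ * a) b h₁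
    obtain ⟨h₄, e₄⟩ := hρt h₂
    rw [e₂, e₄]
    exact e₃.trans (Affine.Point.some_eq_some_of_eq (by rw [map_mul, hz]) rfl)
  · -- `x ∉ 𝒪_𝔓`: both sides are `Õ`
    rw [not_le] at hx
    rw [geomReduction_some_of_one_lt hΔ h hx, hρt0,
      geomReduction_some_of_one_lt hΔ h₁ (by rwa [map_mul, hvζ, one_mul])]

end RatSide

/-! ## §5. Over `K`: the reduced CM automorphisms for the datum `red = geomReduction ∘ θ⁻¹ ∘ g₀⁻¹` -/

section KSide

variable {ℓ : ℕ} [Fact ℓ.Prime] {W₀ : WeierstrassCurve ℚ} [W₀.IsGloballyMinimal]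
  (hΔ : ¬ (ℓ : ℤ) ∣ minimalDiscriminantInt W₀)
  {K : Type u} [Field K] [CharZero K] [Algebra.IsAlgebraic ℚ K]

/-- `a₁ = a₂ = a₄ = 0` passes to the reduction `Ẽ = reductionModPrime W₀ ℓ` (the integral model has
the same vanishing coefficients, `map_integralModelInt`). [folklore] -/
private theorem reductionModPrime_a_eq_zero (h₁ : W₀.a₁ = 0) (h₂ : W₀.a₂ = 0) (h₄ : W₀.a₄ = 0) :
    (reductionModPrime W₀ ℓ).a₁ = 0 ∧ (reductionModPrime W₀ ℓ).a₂ = 0 ∧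
      (reductionModPrime W₀ ℓ).a₄ = 0 := by
  have e₁ := congrArg WeierstrassCurve.a₁ (map_integralModelInt W₀)
  have e₂ := congrArg WeierstrassCurve.a₂ (map_integralModelInt W₀)
  have e₄ := congrArg WeierstrassCurve.a₄ (map_integralModelInt W₀)
  rw [map_a₁, eq_intCast, h₁] at e₁
  rw [map_a₂, eq_intCast, h₂] at e₂
  rw [map_a₄, eq_intCast, h₄] at e₄
  have e₁' : (integralModelInt W₀).a₁ = 0 := by exact_mod_cast e₁
  have e₂' : (integralModelInt W₀).a₂ = 0 := by exact_mod_cast e₂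
  have e₄' : (integralModelInt W₀).a₄ = 0 := by exact_mod_cast e₄
  refine ⟨?_, ?_, ?_⟩
  · rw [reductionModPrime, map_a₁, e₁', map_zero]
  · rw [reductionModPrime, map_a₂, e₂', map_zero]
  · rw [reductionModPrime, map_a₄, e₄', map_zero]

omit [W₀.IsGloballyMinimal] in
/-- `θ⁻¹ ∘ g` on an affine point of `E(K̄)`: the coordinates are moved to `ℚ̄` along
`(absClosureEquiv ℚ K)⁻¹ ∘ g` (definitionally). [folklore] -/
private theorem pointsEquiv_symm_smul_some (g : absoluteGaloisGroup K) {x y : AlgebraicClosure K}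
    (h : ((W₀.baseChange K).baseChange (AlgebraicClosure K)).toAffine.Nonsingular x y) :
    ∃ h', (RatClosure.pointsEquiv (K := K) W₀).symm
        (@HSMul.hSMul (absoluteGaloisGroup K) (geomPoints (W₀.baseChange K))
          (geomPoints (W₀.baseChange K)) instHSMul g (Affine.Point.some x y h)) =
      (Affine.Point.some ((absClosureEquiv ℚ K).symm (g • x)) ((absClosureEquiv ℚ K).symm (g • y)) h' :
        W₀.geomPoints) :=
  ⟨_, rfl⟩

/-- **The reduced CM automorphisms `ρ̃` and the FLIP, for the tree's reduction datum.**  Let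
`E = W₀/ℚ` be globally minimal with `a₁ = a₂ = a₄ = 0`, `ℓ ∤ Δ_{W₀}`, `K/ℚ` an algebraic field,
`g₀ ∈ Γ_K`, and `red : E(K̄) → Ẽ(𝔽̄_ℓ)` the map `red x = geomReduction hΔ (θ⁻¹ (g₀⁻¹ x))`
(`θ = RatClosure.pointsEquiv`; the first conjunct of the reduction data of the tree).  Let
`(ρ_i)_{i ∈ ι}` be maps of `E(K̄)` fixing `O` and acting on affine points by `(x, y) ↦ (c_i x, y)`
with `c_i³ = 1` (the CM automorphisms `ρ_g = [(g v / v)²]` of `CubicTwistTransportJZero`).  Then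
there are automorphisms `ρ̃_i` of the group `Ẽ(𝔽̄_ℓ)` and `z_i ∈ 𝔽̄_ℓ` with `z_i³ = 1` such that
(i) `ρ̃_i (X, Y) = (z_i X, Y)`; (ii) **`red (ρ_i x) = ρ̃_i (red x)`** for all `x ∈ E(K̄)`
(`z_i` is the residue of `θ⁻¹(g₀⁻¹ c_i)`, §4); (iii) if `ℓ ≡ 2 (mod 3)`, for the `ℓ`-power
Frobenius `φ₀ ∈ Γ_{𝔽_ℓ}`: **`ρ̃_i (φ₀ b) = φ₀ (ρ̃_i (ρ̃_i b))`** for all `b ∈ Ẽ(𝔽̄_ℓ)` (§3).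
[cite: Silverman1994, Thm. II.2.2 (a), II.§4] [cite: Lang1987, Ch. 9 §1 (PDF pp. 82–83)]
[cite: SilvermanAEC2009, Thm. III.10.1, Prop. VII.2.1] -/
theorem exists_reduced_mulX (h₁ : W₀.a₁ = 0) (h₂ : W₀.a₂ = 0) (h₄ : W₀.a₄ = 0)
    (g₀ : absoluteGaloisGroup K)
    {red : geomPoints (W₀.baseChange K) → (reductionModPrime W₀ ℓ).geomPoints}
    (hred : ∀ x, red x = geomReduction hΔ ((RatClosure.pointsEquiv (K := K) W₀).symm (g₀⁻¹ • x)))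
    {ι : Type v} {c : ι → AlgebraicClosure K} (hc : ∀ i, c i ^ 3 = 1)
    {ρ : ι → geomPoints (W₀.baseChange K) → geomPoints (W₀.baseChange K)} (hρ0 : ∀ i, ρ i 0 = 0)
    (hρ : ∀ (i : ι) {x y : AlgebraicClosure K}
      (h : ((W₀.baseChange K).baseChange (AlgebraicClosure K)).toAffine.Nonsingular x y),
      ∃ h', ρ i (.some x y h) = .some (c i * x) y h') :
    ∃ (ρt : ι → (reductionModPrime W₀ ℓ).geomPoints ≃+ (reductionModPrime W₀ ℓ).geomPoints)
      (z : ι → AlgebraicClosure (ZMod ℓ)),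
      (∀ i, z i ^ 3 = 1) ∧
      (∀ (i : ι) {X Y : AlgebraicClosure (ZMod ℓ)}
        (h : ((reductionModPrime W₀ ℓ).baseChange (AlgebraicClosure (ZMod ℓ))).toAffine.Nonsingular X Y),
        ∃ h', ρt i (.some X Y h) = .some (z i * X) Y h') ∧
      (∀ i x, red (ρ i x) = ρt i (red x)) ∧
      (ℓ % 3 = 2 → ∀ {φ₀ : absoluteGaloisGroup (ZMod ℓ)},
        (∀ x : AlgebraicClosure (ZMod ℓ), φ₀ • x = x ^ ℓ) →
        ∀ i b, ρt i (φ₀ • b) = φ₀ • ρt i (ρt i b)) := by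
  obtain ⟨ha₁, ha₂, ha₄⟩ := reductionModPrime_a_eq_zero (ℓ := ℓ) h₁ h₂ h₄
  -- the roots of unity `ζ_i = θ⁻¹(g₀⁻¹ c_i) ∈ ℚ̄` and their residues `z_i`
  obtain ⟨ζ, hζ⟩ : ∃ ζ : ι → AlgebraicClosure ℚ,
      ∀ i, ζ i = (absClosureEquiv ℚ K).symm (g₀⁻¹ • c i) := ⟨_, fun _ ↦ rfl⟩
  have hζ3 : ∀ i, ζ i ^ 3 = 1 := fun i ↦ by
    rw [hζ, ← map_pow, ← smul_pow', hc, smul_one, map_one]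
  obtain ⟨z, hz⟩ : ∃ z : ι → AlgebraicClosure (ZMod ℓ),
      ∀ i, placeResidueMap ℓ ⟨ζ i, mem_placeOver_of_pow_eq_one three_ne_zero (hζ3 i)⟩ = z i :=
    ⟨_, fun _ ↦ rfl⟩
  have hz3 : ∀ i, z i ^ 3 = 1 := fun i ↦ by
    rw [← hz]; exact placeResidueMap_pow_eq_one three_ne_zero (hζ3 i)
  have hex := fun i ↦ exists_mulX_geomPoints (reductionModPrime W₀ ℓ) ha₁ ha₂ ha₄ (hz3 i)
  refine ⟨fun i ↦ Classical.choose (hex i), z, hz3, fun i ↦ Classical.choose_spec (hex i),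
    fun i x ↦ ?_, fun hℓ3 φ₀ hφ i b ↦ ?_⟩
  · -- (ii) `red ∘ ρ_i = ρ̃_i ∘ red`
    rw [hred, hred]
    rcases x with _ | ⟨x, y, h⟩
    · show geomReduction hΔ ((RatClosure.pointsEquiv (K := K) W₀).symm (g₀⁻¹ • ρ i 0)) =
        Classical.choose (hex i) (geomReduction hΔ ((RatClosure.pointsEquiv (K := K) W₀).symm
          (g₀⁻¹ • (0 : geomPoints (W₀.baseChange K)))))
      rw [hρ0, smul_zero, map_zero, map_zero, map_zero]
    · obtain ⟨h₅, e₅⟩ := hρ i h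
      obtain ⟨h₆, e₆⟩ := pointsEquiv_symm_smul_some (W₀ := W₀) g₀⁻¹ h₅
      obtain ⟨h₇, e₇⟩ := pointsEquiv_symm_smul_some (W₀ := W₀) g₀⁻¹ h
      have hx' : (absClosureEquiv ℚ K).symm (g₀⁻¹ • (c i * x)) =
          ζ i * (absClosureEquiv ℚ K).symm (g₀⁻¹ • x) := by
        rw [smul_mul', map_mul, ← hζ]
      obtain ⟨h₈, e₈⟩ : ∃ h₈, (Affine.Point.some ((absClosureEquiv ℚ K).symm (g₀⁻¹ • (c i * x)))
          ((absClosureEquiv ℚ K).symm (g₀⁻¹ • y)) h₆ : W₀.geomPoints) =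
          Affine.Point.some (ζ i * (absClosureEquiv ℚ K).symm (g₀⁻¹ • x))
            ((absClosureEquiv ℚ K).symm (g₀⁻¹ • y)) h₈ :=
        ⟨hx' ▸ h₆, Affine.Point.some_eq_some_of_eq hx' rfl⟩
      rw [e₅, e₆, e₈, e₇]
      exact geomReduction_mulX_of_eq_some hΔ three_ne_zero (hζ3 i) (hz i) (map_zero _)
        (Classical.choose_spec (hex i)) rfl rfl
  · -- (iii) the FLIP
    exact mulX_frobenius_flip (hz3 i) (map_zero _) (Classical.choose_spec (hex i)) hφ hℓ3 b

end KSide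

/-! ## §6. The one-call dictionary for the CM frame (`KolyvaginClassFlipSupersingular` §4) -/

section Frame

variable {ℓ : ℕ} [Fact ℓ.Prime] {W₀ : WeierstrassCurve ℚ} [W₀.IsGloballyMinimal]
  (hΔ : ¬ (ℓ : ℤ) ∣ minimalDiscriminantInt W₀)
  {K : Type u} [Field K] [CharZero K] [Algebra.IsAlgebraic ℚ K]

/-- **The reduction dictionary for the CM frame, one call.**  Data: `E₀ = W₀/ℚ` globally minimal
with `a₁ = a₂ = a₄ = 0` and `ℓ ∤ Δ_{W₀}`, `ℓ ≡ 2 (mod 3)`; the frame curve `W/K` (e.g. a short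
`j = 0` model) with a `Γ_K`-equivariant transport `κ : W(K̄) ≃+ E₀(K̄)` diagonal on `x`
(`exists_frameTransport`); the CM automorphisms `ρ_i` of `W(K̄)`, `ρ_i(x, y) = (c_i x, y)`,
`c_i³ = 1`; the reduction datum of `E₀` at a prime `𝔓 ∣ λ ∣ ℓ`: `red₀ x = geomReduction hΔ (θ⁻¹ (g₀⁻¹ x))`,
`φ = φ₀` the `ℓ`-power Frobenius, `red₀` invariant under a subgroup `I ≤ Γ_K` (inertia),
`red₀ ∘ F = φ² ∘ red₀`, `red₀` injective on `E₀[n]`; and `red = red₀ ∘ κ` on `W(K̄)`.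
Conclusion: there are `ρ̃_i : Ẽ(𝔽̄_ℓ) →+ Ẽ(𝔽̄_ℓ)` with
**`red (ρ_i x) = ρ̃_i (red x)`** and **`ρ̃_i (φ b) = φ (ρ̃_i (ρ̃_i b))`** — the hypotheses `hredρ`,
`hφρ` of `JZero.zsmul_kolyvaginClass_cubicTwist_mem_selmerLocalKer_iff_mem_torsionLocalKer` — and
`red` is again `I`-invariant, satisfies `red ∘ F = φ² ∘ red`, and is injective on `W[n]` (its
hypotheses `hredI`, `hredF`, `hred`).  Proof: §2 (`κ ∘ ρ_i = ρ⁰_i ∘ κ` for the automorphism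
`ρ⁰_i = [c_i]` of `E₀(K̄)`, §1), §5 for `ρ⁰`, and the equivariance of `κ`.
[cite: Silverman1994, Thm. II.2.2 (a), II.§4] [cite: Lang1987, Ch. 9 §1 (PDF pp. 82–83)]
[cite: SilvermanAEC2009, Thm. III.10.1, Prop. VII.2.1] [cite: GrossLMS1991, Prop. 6.2 (2)]
[cite: McCallumLMS1991, Prop. 4.4] -/
theorem exists_reduced_mulX_frame (h₁ : W₀.a₁ = 0) (h₂ : W₀.a₂ = 0) (h₄ : W₀.a₄ = 0)
    (hℓ3 : ℓ % 3 = 2)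
    -- the frame curve and its transport to `E₀(K̄)`
    {W : WeierstrassCurve K} (κ : geomPoints W ≃+ geomPoints (W₀.baseChange K))
    (hκG : ∀ (g : absoluteGaloisGroup K) (P : geomPoints W), κ (g • P) = g • κ P)
    {a b d : AlgebraicClosure K}
    (hκ : ∀ {x y : AlgebraicClosure K} (h : (W.baseChange (AlgebraicClosure K)).toAffine.Nonsingular x y),
      ∃ h', κ (.some x y h) = .some (a * x) (b * y + d) h')
    -- the CM automorphisms of the frame
    {ι : Type v} {c : ι → AlgebraicClosure K} (hc : ∀ i, c i ^ 3 = 1)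
    (ρ : ι → geomPoints W ≃+ geomPoints W)
    (hρ : ∀ (i : ι) {x y : AlgebraicClosure K}
      (h : (W.baseChange (AlgebraicClosure K)).toAffine.Nonsingular x y),
      ∃ h', ρ i (.some x y h) = .some (c i * x) y h')
    -- the reduction datum of `E₀` and the reduction of the frame
    (g₀ : absoluteGaloisGroup K)
    {red₀ : geomPoints (W₀.baseChange K) → (reductionModPrime W₀ ℓ).geomPoints}
    (hred₀ : ∀ x, red₀ x = geomReduction hΔ ((RatClosure.pointsEquiv (K := K) W₀).symm (g₀⁻¹ • x)))
    {φ₀ : absoluteGaloisGroup (ZMod ℓ)} (hφ₀ : ∀ x : AlgebraicClosure (ZMod ℓ), φ₀ • x = x ^ ℓ)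
    {φ : (reductionModPrime W₀ ℓ).geomPoints →+ (reductionModPrime W₀ ℓ).geomPoints}
    (hφ : ∀ b, φ b = φ₀ • b)
    {I : Subgroup (absoluteGaloisGroup K)} (hredI₀ : ∀ τ ∈ I, ∀ x, red₀ (τ • x) = red₀ x)
    {F : absoluteGaloisGroup K} (hredF₀ : ∀ x, red₀ (F • x) = φ (φ (red₀ x)))
    {n : ℤ} (hinj₀ : ∀ x, n • x = 0 → red₀ x = 0 → x = 0)
    {red : geomPoints W →+ (reductionModPrime W₀ ℓ).geomPoints} (hred : ∀ x, red x = red₀ (κ x)) :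
    ∃ ρt : ι → (reductionModPrime W₀ ℓ).geomPoints →+ (reductionModPrime W₀ ℓ).geomPoints,
      (∀ i x, red (ρ i x) = ρt i (red x)) ∧
      (∀ i b, ρt i (φ b) = φ (ρt i (ρt i b))) ∧
      (∀ τ ∈ I, ∀ x, red (τ • x) = red x) ∧
      (∀ x, red (F • x) = φ (φ (red x))) ∧
      (∀ x, n • x = 0 → red x = 0 → x = 0) := by
  -- the CM automorphisms `ρ⁰_i = [c_i]` of `E₀(K̄)` and `κ ∘ ρ_i = ρ⁰_i ∘ κ`
  have hex₀ := fun i ↦ exists_mulX_geomPoints (W₀.baseChange K)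
    (show algebraMap ℚ K W₀.a₁ = 0 by rw [h₁, map_zero])
    (show algebraMap ℚ K W₀.a₂ = 0 by rw [h₂, map_zero])
    (show algebraMap ℚ K W₀.a₄ = 0 by rw [h₄, map_zero]) (hc i)
  have hcomm : ∀ i P, κ (ρ i P) = Classical.choose (hex₀ i) (κ P) := fun i P ↦
    frame_mulX_comm (map_zero κ) hκ (map_zero (ρ i)) (hρ i)
      (map_zero (Classical.choose (hex₀ i))) (Classical.choose_spec (hex₀ i)) P
  obtain ⟨ρt, z, -, -, hredρ, hflip⟩ := exists_reduced_mulX hΔ h₁ h₂ h₄ g₀ hred₀ hc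
    (ρ := fun i ↦ ⇑(Classical.choose (hex₀ i)))
    (fun i ↦ map_zero (Classical.choose (hex₀ i))) (fun i ↦ Classical.choose_spec (hex₀ i))
  refine ⟨fun i ↦ (ρt i).toAddMonoidHom, fun i x ↦ ?_, fun i b' ↦ ?_, fun τ hτ x ↦ ?_,
    fun x ↦ ?_, fun x hnx hx ↦ ?_⟩
  · rw [hred, hred, hcomm, hredρ]
    rfl
  · change ρt i (φ b') = φ (ρt i (ρt i b'))
    rw [hφ, hφ]
    exact hflip hℓ3 hφ₀ i b'
  · rw [hred, hred, hκG, hredI₀ τ hτ]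
  · rw [hred, hred, hκG, hredF₀]
  · rw [hred] at hx
    have hκx : κ x = 0 := hinj₀ _ (by rw [← map_zsmul, hnx, map_zero]) hx
    exact κ.map_eq_zero_iff.mp hκx

end Frame

end JZero

end Literature.NumberTheory.EllipticCurves

end
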